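import Summits.HodgeConjecture.HodgeConjecture.Theorems.HLiu418E1pRealise
import Literature.NumberTheory.Automorphic.UnitaryGroupDiscreteRepCentralCharacter
import Literature.NumberTheory.Automorphic.UnitaryGroupAdelicProduct
import HarnessLib

/-!
# Crux `HLiu418`, line LD1 (`stub_S1_facts` in-house), organ (P) — piece (P♭-c): TWO `(1,0)`-TYPE DISCRETE `P`, `P′` WITH A COMMON
# FINITE COMPONENT HAVE THE SAME CENTRAL CHARACTER

Cell `hodgecm-mathlib`, FLOOR 0, line LD1 of the «GO 500» fan (socket 27458 `Cruxes/HLiu418/Lines/F0_AlbCm.lean`, printed stub `stub_S1_facts`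
= books #73 E1θhol [Liu2021, Prop. D.4 (1)]); skeleton `F0/P6/LD/LD1-plan/g0/StubS1facts.inhouse.skeleton.v1.lean` (6ca608a2419e860d), organ
(P) `stub_thetaDatumPinned : ThetaDatumPinned₂`; seat LD1-p02 (g0); `--supports stmt-HodgeConjecture-24832` (helper).  THEOREMS ONLY — no definition,
no instance, no notation, no `sorry`.

THE MATHEMATICS ([Liu2021, proof of Prop. 4.13 Case 1, l. 2136–2137: «the central character `χ` of `π` … `χ_∞ = 1`»]; [BorelJacquet1979, §4.6]).
Let `P`, `P′ ⊂ L²([U(J)])` be discrete automorphic representations of a rank-2 unitary group `U(J)` (compact automorphic quotient), both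
`H¹`-cohomological of holomorphic type at the complex place `w₁` and both containing the irreducible smooth `σ` of `U(J)(𝔸_f)` — in the HONEST
form the K-lane ★ `E1pRealise.exists_holValued_of_hasFinComponent` provides: a non-zero `σ`-equivariant linear map `ψ : W → holCotForms₂ 𝔣` all of
whose values have their `L²`-classes in `P` (resp. `ψ′` for `P′`).  Then the central characters agree: `ψ_P = ψ_{P′}` on the whole centre
`U(1)(𝔸_F)` (★ `DiscreteAutomorphicRep.exists_centralCharacter_adelicCenter`).  PROOF.  Split the central element `z = u·1₂ = z_∞ · z_f` (★
`archToAdelic_mul_finAdelicToAdelic`).  (§1) The `w₁`-component of `z_∞` is the SCALAR `λ·1₂`, `λ = u_{w₁}`, which obeys the cotangent law of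
`IsConeHol 𝔣` with `(q, a, d) = (λ, λ, 0)`; away from `w₁` holomorphic cotangent forms are right-invariant; hence `f(x · z_∞) = f(x)` for every
`f ∈ holCotForms₂ 𝔣` and `R(z_∞)[f] = [f]` («`χ_∞ = 1`», the `N = 2` twin of ★ `UnitaryGroupHolCotFormsArchCentre`).  (§2) For `w ∈ W`:
`ψ_P(u)•[ψ w] = R(z)[ψ w] = R(z_∞) R(z_f) [ψ w] = R(z_∞)[ψ(σ(z_f) w)] = [ψ(σ(z_f) w)]`, so `ψ(σ(z_f) w − ψ_P(u)•w)` has zero class, hence is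
zero (continuity, ★ `toLp_toQuotFun_ne_zero`), hence `σ(z_f) w = ψ_P(u)•w` (`ψ` is injective: an intertwiner out of an irreducible `σ`,
Mathlib `Representation.IsIrreducible.injective_or_eq_zero`).  The same with `ψ′` gives `σ(z_f) w = ψ_{P′}(u)•w`; `W ≠ 0`.  NO Schur lemma for
`σ`, NO `π_f`-isotypy ([BorelJacquet1979, §4.6]/Flath) and NO weak approximation is used.  (§3) The letter-binder form (CM field `L`, scaled frame
`formCongr c g (t•H) = diag dV`, definiteness away from `ι`): compactness from anisotropy (★ `anisotropic_of_formCongr_posDef`), the two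
realisations from ★ `E1pRealise.holValued_shape`.

HONEST LABEL: HC_CM is proved only modulo the 7 printed citations (2 remaining: hLiu418 = stmt-HodgeConjecture-24832, h413 = stmt-HodgeConjecture-24833)
until rung 0 closes; this file discharges none of them (in-house helper toward organ (P) of line LD1).

## References
* [Liu2021] Y. Liu, *Fourier–Jacobi cycles and arithmetic relative trace formula*, Camb. J. Math. 9 (2021) = arXiv:2102.11518, proof of Prop. 4.13 Case 1
  (l. 2136–2137, p. 48); App. D, proof of Prop. D.4 (1) (p. 131).
* [BorelJacquet1979] A. Borel, H. Jacquet, *Automorphic forms and automorphic representations*, PSPM 33.1 (1979), §4.1, §4.6.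
* [Borel1997] A. Borel, *Automorphic forms on SL₂(ℝ)* (1997), §5.13–§5.14 (forms of `K`-type read on the group).
-/

set_option autoImplicit false
-- the mandated namespace has the single-problem summit's repeated segment (`HodgeConjecture.HodgeConjecture`)
set_option linter.dupNamespace false

noncomputable section

open Matrix MeasureTheory NumberField NumberField.InfinitePlace
open scoped Matrix ComplexOrder
open Literature.NumberTheory.Automorphic Literature.NumberTheory.Automorphic.UnitaryGroup
open Literature.NumberTheory.Automorphic.UnitaryGroup.CotangentForms (toQuotFun)
open Literature.NumberTheory.Automorphic.UnitaryCurveForms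
open Literature.AlgebraicGeometry.ShimuraVarieties
open Summit.HodgeConjecture.HodgeConjecture.Cruxes.H413.SpectrumJunction
open Summit.HodgeConjecture.HodgeConjecture.Cruxes.HLiu418.E2Density
open Summit.HodgeConjecture.HodgeConjecture.Cruxes.HLiu418.E2ArchOrthHolPrep

namespace Summit.HodgeConjecture.HodgeConjecture.Cruxes.HLiu418.F0P6LD1CentralCharacterPin

variable {F E : Type} [Field F] [NumberField F] [Field E] [NumberField E] [Algebra F E]
  {c : E ≃ₐ[F] E} {J : Matrix (Fin 2) (Fin 2) E}
  {hc : c ≠ 1} {hfix : ∀ w : InfinitePlace E, c • w = w} {w₁ : {w : InfinitePlace E // IsComplex w}} {𝔣 : ConeFrame E J w₁}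

/-! ## §1 The archimedean part of a central element acts trivially on holomorphic cotangent forms («`χ_∞ = 1`», rank 2) -/

/-- The `w₁`-component of the archimedean part of the central element `u · 1₂` is a SCALAR matrix `λ · 1₂` with `λ ≠ 0`
(`λ = ` the `w₁`-coordinate of `u_∞`). [cite: BorelJacquet1979, §4.1] -/
theorem exists_coe_archAt_archPart_adelicCenter_eq_smul_one (u : adelicOne F E c) :
    ∃ l : ℂ, l ≠ 0 ∧
      (((archAt F E c 2 J w₁ (hfix w₁.1) hc (archPart F E c 2 J (adelicCenter F E c 2 J u)) : archLocal E 2 J w₁) :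
          GL (Fin 2) ℂ) : Matrix (Fin 2) (Fin 2) ℂ) =
        l • (1 : Matrix (Fin 2) (Fin 2) ℂ) := by
  set l : ℂ := (InfiniteAdeleRing.ringEquiv_mixedSpace E (((u : (AdeleRing (𝓞 E) E)ˣ) : AdeleRing (𝓞 E) E).1)).2 w₁ with hl
  have hmat : (((archAt F E c 2 J w₁ (hfix w₁.1) hc (archPart F E c 2 J (adelicCenter F E c 2 J u)) : archLocal E 2 J w₁) :
          GL (Fin 2) ℂ) : Matrix (Fin 2) (Fin 2) ℂ) = l • (1 : Matrix (Fin 2) (Fin 2) ℂ) := by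
    ext i j
    rw [coe_archAt_apply, coe_archPart, Literature.NumberTheory.Automorphic.GLn.coe_toMixed_apply]
    change (InfiniteAdeleRing.ringEquiv_mixedSpace E
      (((((adelicCenter F E c 2 J u : adelic F E c 2 J) : GL (Fin 2) (AdeleRing (𝓞 E) E)) :
        Matrix (Fin 2) (Fin 2) (AdeleRing (𝓞 E) E)) i j).1)).2 w₁ = _
    rw [coe_adelicCenter, Matrix.smul_apply, Matrix.smul_apply, Matrix.one_apply, Matrix.one_apply]
    by_cases h : i = j
    · simp only [h, if_true, smul_eq_mul, mul_one, hl]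
    · simp only [h, if_false, smul_zero]
      change ((InfiniteAdeleRing.ringEquiv_mixedSpace E) 0).2 w₁ = 0
      rw [map_zero]
      rfl
  refine ⟨l, fun h0 => ?_, hmat⟩
  -- `λ = 0` would make an invertible matrix vanish
  have hdet := (Matrix.isUnits_det_units
    ((archAt F E c 2 J w₁ (hfix w₁.1) hc (archPart F E c 2 J (adelicCenter F E c 2 J u)) : archLocal E 2 J w₁) : GL (Fin 2) ℂ)).ne_zero
  rw [hmat, h0, zero_smul, Matrix.det_zero] at hdet
  exact hdet rfl

/-- **`f (x · (u·1₂)_∞) = f x`** for every holomorphic cotangent form `f ∈ holCotForms₂ 𝔣` and every central `u ∈ U(1)(𝔸_F)`: the `w₁`-component of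
`(u·1₂)_∞` is a scalar `λ·1₂`, which satisfies the cotangent law of `IsConeHol 𝔣` with `(q,a,d) = (λ,λ,0)` (★ `apply_mul_adelicSingle_mul`), and the
other archimedean components act trivially on `holCotForms₂` (★ `apply_mul_of_mem_holCotForms₂`). [cite: Borel1997, §5.13–§5.14] [cite: BorelJacquet1979, §4.1] -/
theorem apply_mul_archToAdelic_archPart_adelicCenter {f : (adelicGroupData F E c 2 J).Adelic → ℂ}
    (hf : f ∈ holCotForms₂ F E c J hc hfix w₁ 𝔣) (u : adelicOne F E c) (x : (adelicGroupData F E c 2 J).Adelic) :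
    f (x * archToAdelic F E c 2 J (archPart F E c 2 J (adelicCenter F E c 2 J u))) = f x := by
  obtain ⟨a', ha', hsplit⟩ := exists_eq_archSingle_mul F E c 2 J hc hfix w₁ (archPart F E c 2 J (adelicCenter F E c 2 J u))
  set κ := archAt F E c 2 J w₁ (hfix w₁.1) hc (archPart F E c 2 J (adelicCenter F E c 2 J u)) with hκ
  obtain ⟨l, hl0, hmat⟩ := exists_coe_archAt_archPart_adelicCenter_eq_smul_one (J := J) (hc := hc) (hfix := hfix) (w₁ := w₁) u
  have hk : archToAdelic F E c 2 J a' ∈ ((archAt F E c 2 J w₁ (hfix w₁.1) hc).ker).map (archToAdelic F E c 2 J) :=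
    ⟨a', MonoidHom.mem_ker.2 ha', rfl⟩
  rw [hsplit, map_mul, ← adelicSingle_apply, ← mul_assoc, apply_mul_of_mem_holCotForms₂ hf hk]
  have hκv : ((κ : GL (Fin 2) ℂ) : Matrix (Fin 2) (Fin 2) ℂ) *ᵥ 𝔣.v₀ = l • 𝔣.v₀ := by
    rw [← hκ] at hmat
    rw [hmat, Matrix.smul_mulVec, Matrix.one_mulVec]
  have hκt : ((κ : GL (Fin 2) ℂ) : Matrix (Fin 2) (Fin 2) ℂ) *ᵥ 𝔣.t₀ = l • 𝔣.t₀ + (0 : ℂ) • 𝔣.v₀ := by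
    rw [← hκ] at hmat
    rw [hmat, Matrix.smul_mulVec, Matrix.one_mulVec, zero_smul, add_zero]
  have h := apply_mul_adelicSingle_mul hf 1 κ hl0 hκv hκt x
  rw [one_mul, map_one, mul_one, mul_inv_cancel₀ hl0, one_mul] at h
  exact h

section Classes

variable {μ : Measure (adelicGroupData F E c 2 J).automorphicQuotient} [(adelicGroupData F E c 2 J).IsAutomorphicMeasure μ]
  [CompactSpace (adelicGroupData F E c 2 J).automorphicQuotient]

omit [CompactSpace (adelicGroupData F E c 2 J).automorphicQuotient] in
/-- **«`χ_∞ = 1`» on classes**: `R((u·1₂)_∞)[f] = [f]` for the `L²`-class of a holomorphic cotangent form `f`.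
[cite: Liu2021, proof of Prop. 4.13 Case 1, l. 2137] [cite: BorelJacquet1979, §4.6] -/
theorem rightRegular_archPart_adelicCenter_toLp {f : (adelicGroupData F E c 2 J).Adelic → ℂ}
    (hf : f ∈ holCotForms₂ F E c J hc hfix w₁ 𝔣) (u : adelicOne F E c)
    (hfm : MemLp (toQuotFun (adelicGroupData F E c 2 J) f) 2 μ) :
    (adelicGroupData F E c 2 J).rightRegular μ (archToAdelic F E c 2 J (archPart F E c 2 J (adelicCenter F E c 2 J u)))
        (hfm.toLp (toQuotFun (adelicGroupData F E c 2 J) f)) =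
      hfm.toLp (toQuotFun (adelicGroupData F E c 2 J) f) :=
  rightRegular_toLp_of_apply_mul (leftInvariant_of_mem_holCotForms₂ hf) _
    (fun x => apply_mul_archToAdelic_archPart_adelicCenter hf u x) hfm

/-! ## §2 The finite part of the central character is read on a holomorphic realisation of `σ` -/

variable {W : Type} [AddCommGroup W] [Module ℂ W]

/-- **The centre on a holomorphic realisation of `σ` inside `P`.**  Let the centre act on `P` through `χP` and let `ψ : W → holCotForms₂ 𝔣` be
`σ`-equivariant with all classes in `P`.  Then for every central `u` and every `w ∈ W` the class of `ψ (σ (u·1₂)_f w − χP(u) • w)` vanishes: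
`χP(u)•[ψ w] = R(u·1₂)[ψ w] = R((u·1₂)_∞)[ψ(σ((u·1₂)_f) w)] = [ψ(σ((u·1₂)_f) w)]`. [cite: BorelJacquet1979, §4.6] [cite: Liu2021, proof of Prop. 4.13 Case 1, l. 2136–2137] -/
theorem apply_finPart_adelicCenter_sub_smul_eq_zero (P : DiscreteAutomorphicRep (adelicGroupData F E c 2 J) μ)
    {χP : adelicOne F E c →* ℂˣ}
    (hχP : ∀ (u : adelicOne F E c) (v : P.space.toSubmodule),
      P.space.toContRep (adelicCenter F E c 2 J u) v = ((χP u : ℂˣ) : ℂ) • v)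
    (σ : Representation ℂ (finAdelic F E c 2 J) W) (hirr : σ.IsIrreducible)
    (ψ : W →ₗ[ℂ] ((adelicGroupData F E c 2 J).Adelic → ℂ))
    (hψE : ∀ (k : finAdelic F E c 2 J) (w : W), ψ (σ k w) = rightRep₂ F E c J k (ψ w))
    (hψv : ∀ w : W, ψ w ∈ holCotForms₂ F E c J hc hfix w₁ 𝔣 ∧ P.ContainsFun (ψ w)) (hψ0 : ψ ≠ 0)
    (u : adelicOne F E c) (w : W) :
    σ (finPart F E c 2 J (adelicCenter F E c 2 J u)) w = ((χP u : ℂˣ) : ℂ) • w := by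
  -- abbreviations
  set z := adelicCenter F E c 2 J u with hz
  set zinf := archToAdelic F E c 2 J (archPart F E c 2 J z) with hzinf
  set b := finPart F E c 2 J z with hb
  have hzsplit : zinf * finAdelicToAdelic F E c 2 J b = z := archToAdelic_mul_finAdelicToAdelic F E c 2 J z
  -- `ψ` is injective: an intertwiner out of the irreducible `σ`
  haveI := hirr
  let ψI : σ.IntertwiningMap (rightRep₂ F E c J) := LinearMap.intertwiningMap_of_isIntertwiningMap σ (rightRep₂ F E c J) ψ hψE
  have hψI : ∀ w, ψI w = ψ w := fun _ => rfl
  have hψinj : Function.Injective ψ := by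
    rcases Representation.IsIrreducible.injective_or_eq_zero ψI with h | h
    · intro a a' haa
      exact h (by rw [hψI, hψI]; exact haa)
    · exact absurd (LinearMap.ext fun w => by rw [← hψI, h]; rfl) hψ0
  -- the difference `d := σ b w − χP(u) • w` and the class of `ψ d`
  set d : W := σ b w - ((χP u : ℂˣ) : ℂ) • w with hd
  suffices hψd : ψ d = 0 by
    have hd0 : d = 0 := hψinj (by rw [hψd, map_zero])
    exact sub_eq_zero.mp hd0
  -- classes of the values of `ψ`
  have hmem : ∀ w, MemLp (toQuotFun (adelicGroupData F E c 2 J) (ψ w)) 2 μ := fun w => memLp_toQuotFun_self (μ := μ) (hψv w).1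
  have hcls : ∀ w, (hmem w).toLp (toQuotFun (adelicGroupData F E c 2 J) (ψ w)) ∈ P.space.toSubmodule := by
    intro w
    obtain ⟨h1, h1P⟩ := (hψv w).2
    exact h1P
  -- (i) `R(z)[ψ w] = χP(u) • [ψ w]`
  have hRz : (adelicGroupData F E c 2 J).rightRegular μ z ((hmem w).toLp (toQuotFun (adelicGroupData F E c 2 J) (ψ w))) =
      ((χP u : ℂˣ) : ℂ) • (hmem w).toLp (toQuotFun (adelicGroupData F E c 2 J) (ψ w)) := by
    have h := congrArg Subtype.val (hχP u ⟨_, hcls w⟩)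
    rw [ContRepresentation.ClosedSubrep.coe_toContRep_apply] at h
    exact h
  -- (ii) `R(z_f)[ψ w] = [ψ (σ b w)]`
  have hRzf : (adelicGroupData F E c 2 J).rightRegular μ (finAdelicToAdelic F E c 2 J b)
        ((hmem w).toLp (toQuotFun (adelicGroupData F E c 2 J) (ψ w))) =
      (hmem (σ b w)).toLp (toQuotFun (adelicGroupData F E c 2 J) (ψ (σ b w))) := by
    rw [rightRegular_toLp_eq (hψv w).1 (hmem w)]
    exact MemLp.toLp_congr _ _ (Filter.EventuallyEq.of_eq (by
      congr 1
      funext x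
      rw [hψE, rightRep₂_apply]))
  -- (iii) `R(z_∞)[ψ (σ b w)] = [ψ (σ b w)]`
  have hRzinf : (adelicGroupData F E c 2 J).rightRegular μ zinf
        ((hmem (σ b w)).toLp (toQuotFun (adelicGroupData F E c 2 J) (ψ (σ b w)))) =
      (hmem (σ b w)).toLp (toQuotFun (adelicGroupData F E c 2 J) (ψ (σ b w))) :=
    rightRegular_archPart_adelicCenter_toLp (hψv (σ b w)).1 u (hmem (σ b w))
  -- assemble: `[ψ (σ b w)] = χP(u) • [ψ w]`
  have hkey : (hmem (σ b w)).toLp (toQuotFun (adelicGroupData F E c 2 J) (ψ (σ b w))) =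
      ((χP u : ℂˣ) : ℂ) • (hmem w).toLp (toQuotFun (adelicGroupData F E c 2 J) (ψ w)) := by
    rw [← hRz, ← hzsplit, map_mul, mul_apply_eq_comp, hRzf, hRzinf]
  -- the class of `ψ d` is zero, hence `ψ d = 0`
  have hψd_fun : ψ d = ψ (σ b w) - ((χP u : ℂˣ) : ℂ) • ψ w := by rw [hd, map_sub, map_smul]
  have hmemd : MemLp (toQuotFun (adelicGroupData F E c 2 J) (ψ d)) 2 μ := hmem d
  have hcls0 : hmemd.toLp (toQuotFun (adelicGroupData F E c 2 J) (ψ d)) = 0 := by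
    have hsub : hmemd.toLp (toQuotFun (adelicGroupData F E c 2 J) (ψ d)) =
        (hmem (σ b w)).toLp (toQuotFun (adelicGroupData F E c 2 J) (ψ (σ b w))) -
          ((χP u : ℂˣ) : ℂ) • (hmem w).toLp (toQuotFun (adelicGroupData F E c 2 J) (ψ w)) := by
      rw [← MemLp.toLp_const_smul, ← MemLp.toLp_sub]
      exact MemLp.toLp_congr _ _ (Filter.EventuallyEq.of_eq (by
        rw [hψd_fun]
        rfl))
    rw [hsub, hkey, sub_self]
  by_contra hne
  exact toLp_toQuotFun_ne_zero (leftInvariant_of_mem_holCotForms₂ (hψv d).1)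
    (continuous_of_mem_holCotForms₂ F E c J hc hfix w₁ 𝔣 (hψv d).1) hmemd hne hcls0

/-- **TWO HOLOMORPHIC REALISATIONS OF THE SAME `σ` SEE THE SAME CENTRAL CHARACTER.**  If the centre acts on `P` through `χP` and on `P′` through
`χP′`, and the irreducible `σ` (on `W`) is realised `σ`-equivariantly by holomorphic cotangent forms with classes in `P` (by `ψ ≠ 0`) and in `P′`
(by `ψ′ ≠ 0`), then `χP = χP′`. [cite: BorelJacquet1979, §4.6] [cite: Liu2021, proof of Prop. 4.13 Case 1, l. 2136–2137; proof of Prop. D.4 (1) p. 131] -/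
theorem centralCharacter_eq_of_holValued (P P' : DiscreteAutomorphicRep (adelicGroupData F E c 2 J) μ)
    {χP χP' : adelicOne F E c →* ℂˣ}
    (hχP : ∀ (u : adelicOne F E c) (v : P.space.toSubmodule),
      P.space.toContRep (adelicCenter F E c 2 J u) v = ((χP u : ℂˣ) : ℂ) • v)
    (hχP' : ∀ (u : adelicOne F E c) (v : P'.space.toSubmodule),
      P'.space.toContRep (adelicCenter F E c 2 J u) v = ((χP' u : ℂˣ) : ℂ) • v)
    (σ : Representation ℂ (finAdelic F E c 2 J) W) (hirr : σ.IsIrreducible)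
    (ψ : W →ₗ[ℂ] ((adelicGroupData F E c 2 J).Adelic → ℂ))
    (hψE : ∀ (k : finAdelic F E c 2 J) (w : W), ψ (σ k w) = rightRep₂ F E c J k (ψ w))
    (hψv : ∀ w : W, ψ w ∈ holCotForms₂ F E c J hc hfix w₁ 𝔣 ∧ P.ContainsFun (ψ w)) (hψ0 : ψ ≠ 0)
    (ψ' : W →ₗ[ℂ] ((adelicGroupData F E c 2 J).Adelic → ℂ))
    (hψ'E : ∀ (k : finAdelic F E c 2 J) (w : W), ψ' (σ k w) = rightRep₂ F E c J k (ψ' w))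
    (hψ'v : ∀ w : W, ψ' w ∈ holCotForms₂ F E c J hc hfix w₁ 𝔣 ∧ P'.ContainsFun (ψ' w)) (hψ'0 : ψ' ≠ 0) :
    χP = χP' := by
  obtain ⟨w₀, hw₀⟩ := E1pRealise.exists_ne_zero_of_isIrreducible σ hirr
  refine MonoidHom.ext fun u => Units.ext ?_
  have h1 := apply_finPart_adelicCenter_sub_smul_eq_zero P hχP σ hirr ψ hψE hψv hψ0 u w₀
  have h2 := apply_finPart_adelicCenter_sub_smul_eq_zero P' hχP' σ hirr ψ' hψ'E hψ'v hψ'0 u w₀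
  exact smul_left_injective ℂ hw₀ (h1.symm.trans h2)

end Classes

/-! ## §3 At the letter binders of #73 (CM field, scaled frame, definiteness away from `ι`) -/

/-- **(P♭-c) AT THE LETTER BINDERS — `centralCharacter_eq_of_hasFinComponent`.**  For the data of ★ `Rogawski1990.curveThetaCohFinComponentUnique_hol`
(CM `L` with `[L:ℚ] ≥ 4`, `ι`, `H`, scaled frame `formCongr c g (t•H) = diag dV` of signature `(1,1)` at `ι` and definite elsewhere, cone frame `𝔣`,
automorphic measure `μ`, an irreducible smooth `σ` of `U(H)(𝔸_{L⁺,f})`): two discrete automorphic `P`, `P′` of `U(H)`, both of Hodge type `(1,0)` at `ι`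
(`IsHolCotangentAt₂ … 𝔣`) and both with finite component `σ` (`HasFinComponent`), have THE SAME CENTRAL CHARACTER: whenever the centre `u ↦ u·1_H` acts on
`P` through `χP` and on `P′` through `χP′` (★ `DiscreteAutomorphicRep.exists_centralCharacter_adelicCenter`), `χP = χP′`.  Compactness of `[U(H)]` from the
definiteness clause (★ `S1BettiSliceExclusion.anisotropic_of_formCongr_posDef`), the holomorphic realisations of `σ` from ★ `E1pRealise.holValued_shape`.
[cite: Liu2021, App. D, proof of Prop. D.4 (1) p. 131; proof of Prop. 4.13 Case 1 l. 2136–2137] [cite: BorelJacquet1979, §4.6] -/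
theorem centralCharacter_eq_of_hasFinComponent
    (L : Type) [Field L] [NumberField L] [IsCMField L] (ι : L →+* ℂ) (H : Matrix (Fin 2) (Fin 2) L)
    (dV : Fin 2 → L) (hdV : ∀ i, IsCMField.complexConj L (dV i) = dV i) (hdV0 : ∀ i, dV i ≠ 0)
    (t : L) (ht : t ≠ 0) (g : GL (Fin 2) L)
    (hg : formCongr ((IsCMField.complexConj L : L ≃ₐ[↥(maximalRealSubfield L)] L) : L →+* L) g (t • H) = Matrix.diagonal dV)
    (hsig : ∃ T : GL (Fin 2) ℂ, formCongr (starRingEnd ℂ) T ((Matrix.diagonal dV).map ι) = Matrix.diagonal ![(1 : ℂ), -1])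
    (hdef : ∀ τ' : L →+* ℂ, InfinitePlace.mk τ' ≠ InfinitePlace.mk ι → ((Matrix.diagonal dV).map τ').PosDef)
    (h4 : 4 ≤ Module.finrank ℚ L) (𝔣 : ConeFrame L H (cmPlace L ι))
    (μ : Measure (adelicGroupData (↥(maximalRealSubfield L)) L (IsCMField.complexConj L) 2 H).automorphicQuotient)
    [(adelicGroupData (↥(maximalRealSubfield L)) L (IsCMField.complexConj L) 2 H).IsAutomorphicMeasure μ]
    (W : Type) [AddCommGroup W] [Module ℂ W]
    (σ : Representation ℂ (finAdelic (↥(maximalRealSubfield L)) L (IsCMField.complexConj L) 2 H) W)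
    (hirr : σ.IsIrreducible) (hsm : σ.IsSmooth)
    (P P' : DiscreteAutomorphicRep (adelicGroupData (↥(maximalRealSubfield L)) L (IsCMField.complexConj L) 2 H) μ)
    (hP : P.IsHolCotangentAt₂ (IsCMField.complexConj_ne_one L) (UnitaryGroup.complexConj_smul_infinitePlace L) (cmPlace L ι) 𝔣)
    (hP' : P'.IsHolCotangentAt₂ (IsCMField.complexConj_ne_one L) (UnitaryGroup.complexConj_smul_infinitePlace L) (cmPlace L ι) 𝔣)
    (hPσ : P.HasFinComponent σ) (hP'σ : P'.HasFinComponent σ)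
    {χP χP' : ↥(adelicOne (↥(maximalRealSubfield L)) L (IsCMField.complexConj L)) →* ℂˣ}
    (hχP : ∀ (u : ↥(adelicOne (↥(maximalRealSubfield L)) L (IsCMField.complexConj L))) (v : P.space.toSubmodule),
      P.space.toContRep (adelicCenter (↥(maximalRealSubfield L)) L (IsCMField.complexConj L) 2 H u) v = ((χP u : ℂˣ) : ℂ) • v)
    (hχP' : ∀ (u : ↥(adelicOne (↥(maximalRealSubfield L)) L (IsCMField.complexConj L))) (v : P'.space.toSubmodule),
      P'.space.toContRep (adelicCenter (↥(maximalRealSubfield L)) L (IsCMField.complexConj L) 2 H u) v = ((χP' u : ℂˣ) : ℂ) • v) :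
    χP = χP' := by
  obtain ⟨τ, hτ⟩ := UnitaryGroup.exists_infinitePlace_ne L h4 ι
  have hanis := S1BettiSliceExclusion.anisotropic_of_formCongr_posDef L H t g dV hg τ (hdef τ hτ)
  haveI := UnitaryGroup.compactSpace_adelicGroupData_automorphicQuotient L 2 H hanis
  obtain ⟨ψ, hψE, hψv, hψ0⟩ :=
    E1pRealise.holValued_shape L ι H dV hdV hdV0 t ht g hg hsig hdef h4 𝔣 μ W σ hirr hsm P hP hPσ
  obtain ⟨ψ', hψ'E, hψ'v, hψ'0⟩ :=
    E1pRealise.holValued_shape L ι H dV hdV hdV0 t ht g hg hsig hdef h4 𝔣 μ W σ hirr hsm P' hP' hP'σ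
  exact centralCharacter_eq_of_holValued P P' hχP hχP' σ hirr ψ hψE hψv hψ0 ψ' hψ'E hψ'v hψ'0

end Summit.HodgeConjecture.HodgeConjecture.Cruxes.HLiu418.F0P6LD1CentralCharacterPin

end
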